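import Summits.CriticalPhenomena.SAWScalingLimit.Theorems.SAWRenewalTightnessAnnularMassDecayFirstDescentFactorisation

/-!
# The skip family versus the first-entry family, sharpened: the suffix is IRREDUCIBLE (stub S3)

Line `radial-renewal-kesten-inequality` of the crux `AnnularMassDecay` (stmt-CriticalPhenomena-4729),
support for the OPEN stub S3 `stub_skipTail`; sequel to `…SkipFirstEntry` (self-contained).  Notation as there:
`ρ_u = dist (Site.toComplex u) z`, `Skip(u;A,s)[N]` the skip mass (level-`ρ_u/A` chain-stopped
members from `u` with end radius `≤ s`), `annMass z s ρ_u u N` the crux's first-entry family.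

The first-entry cut of `…SkipFirstEntry` maps a re-entrant skipping member to (annular bridge `β`
into the closed `s`-disc) × (returning record-ending descent `τ` from `w = u + β_m`).  That file's
suffix family forgets one clause which the suffix DOES satisfy: since every strict record of `τ`
has radius `< |w - z| ≤ s`, below all radii of the prefix, a radial renewal time of `τ` would be a
renewal time of the whole member of radius `≤ s ≤ ρ_u/A`, which the skip clause forbids.  So `τ` is
RADIALLY IRREDUCIBLE: it has no renewal time before its end (`rr_st_profile_suffix_irr`).  This
matters: without the clause the suffix family contains every returning record-ending descent, whose
total `x_c`-mass is a "number of record levels"-type quantity expected to GROW with the scale (like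
`Σ_v U(w,v)`, cf. `E[#renewal levels] ≍ s^{3/4}`), so the boundedness hypothesis (ii) of
`rr_st_skipTail_of_annularDecay` is presumably false as stated there (the implication stays true but
idle); with the clause the suffix family is a family of radially irreducible descents — the objects
whose mass `k(·)` is the bounded, renewal-normalised quantity of the line (`k ≤ 1.1` in every scan).

* `rr_st_firstEntry_factorisation_irr` — `Skip(u;A,s)[N] ≤ Σ_{m ≤ N} Σ_β x_c^m · RetIrr(u + β_m; s)[N]
  + annMass z s ρ_u u N` for `A > 1`, `s ≤ ρ_u/A`, where `RetIrr(w;s)[N]` is the `x_c`-mass of walks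
  `τ` of length `0 < k ≤ N` from `w`, confined to the open disc of radius `ρ_u` about `z`, whose end
  is a strict radial record of radius `≤ s`, which reach radius `≥ |w - z|` at some time `0 < j < k`,
  and none of whose radial renewal times `0 < t < k` has radius `≤ s` (equivalently: no renewal).
* `rr_st_skipTail_of_annularDecay_irr` (registered helper) — S3 follows, with `κ = θ`, from the
  crux-type decay `annMass z r R u N ≤ C (r/R)^θ` (`1 ≤ r < R ≤ ρ_u`) together with a uniform bound
  `RetIrr(w;s)[N] ≤ K` (`1 ≤ s`, `|w - z| ≤ s < ρ`): an S1-type boundedness statement for radially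
  IRREDUCIBLE descents from a bulk point (cf. `stub_chainBounded`, which is the case of a start on
  the boundary of its disc), open like S1.

Sources: H. Kesten, J. Math. Phys. 4 (1963); N. Madras, G. Slade, *The Self-Avoiding Walk* (1993)
§1.2, §4.2. [folklore]
-/

noncomputable section

namespace Summit.CriticalPhenomena.SAWScalingLimit.Theorems.AnnularMassDecay.Radial

open scoped BigOperators Classical
open Literature.Probability.LatticeModels Literature.Probability.RandomPlanarGeometry
open Summit.CriticalPhenomena.SAWScalingLimit.Theorems.AnnularMassDecay.Negative (criticalFugacity_pos)

/-! ### The suffix of the first-entry cut is radially irreducible -/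

/-- **Suffix of the first-entry cut, sharpened.** As `rr_st_profile_suffix`, plus: no radial renewal
time `0 < t' < n - t` of the suffix profile has radius `≤ s` (indeed none at all: a renewal `t'` of
the suffix of radius `≤ s` is the renewal `t + t'` of the whole profile — earlier times are farther,
being either `> s` (times `< t`, by minimality of `t`), `= ρ` (time `0`), or suffix times — of radius
`≤ s ≤ L`, excluded by the skip clause). [folklore] -/
theorem rr_st_profile_suffix_irr {r r'' : ℕ → ℝ} {ρ s L ρw : ℝ} {n t : ℕ}
    (h : r n ≤ s ∧ 0 < n ∧ (∀ i, 0 < i → i ≤ n → r i < ρ) ∧ (∀ i, i < n → r n < r i) ∧ r n ≤ L ∧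
      (∀ t, 0 < t → t < n → (∀ i, i < t → r t < r i) →
        (∀ j, t < j → j ≤ n → r j < r t) → L < r t))
    (hsL : s ≤ L) (h0 : r 0 = ρ) (ht0 : 0 < t) (htn : t < n) (ht : r t ≤ s)
    (hmin : ∀ t', t' < t → ¬ (0 < t' ∧ t' < n ∧ r t' ≤ s)) (hρw : ρw = r t)
    (hr'' : ∀ i, i ≤ n - t → r'' i = r (t + i)) :
    0 < n - t ∧ (∀ i, i ≤ n - t → r'' i < ρ) ∧ (∀ i, i < n - t → r'' (n - t) < r'' i) ∧
      r'' (n - t) ≤ s ∧ (∃ j, 0 < j ∧ j < n - t ∧ ρw ≤ r'' j) ∧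
      (∀ t', 0 < t' → t' < n - t → (∀ i, i < t' → r'' t' < r'' i) →
        (∀ j, t' < j → j ≤ n - t → r'' j < r'' t') → s < r'' t') := by
  obtain ⟨hns, -, hconf, hrec, -, hren⟩ := h
  have hm : r'' (n - t) = r n := by rw [hr'' _ le_rfl, Nat.add_sub_of_le htn.le]
  -- `t` is a strict record of radius `≤ s ≤ L`; no renewal there, and the end is closer
  have hrect : ∀ i, i < t → r t < r i := by
    intro i hit
    rcases Nat.eq_zero_or_pos i with rfl | hi0
    · rw [h0]
      exact hconf t ht0 htn.le
    · by_contra hle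
      exact hmin i hit ⟨hi0, hit.trans htn, (not_lt.1 hle).trans ht⟩
  have hret : ∃ j, 0 < j ∧ j < n - t ∧ ρw ≤ r'' j := by
    have hnot : ¬ ∀ j, t < j → j ≤ n → r j < r t := by
      intro hF
      have := hren t ht0 htn hrect hF
      linarith
    push Not at hnot
    obtain ⟨j, htj, hjn, hj⟩ := hnot
    have hjn' : j < n := by
      rcases hjn.lt_or_eq with hlt | rfl
      · exact hlt
      · exact absurd (hrec t htn) (not_lt.2 hj)
    refine ⟨j - t, by omega, by omega, ?_⟩
    rw [hρw, hr'' (j - t) (by omega), Nat.add_sub_cancel' htj.le]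
    exact hj
  refine ⟨Nat.sub_pos_of_lt htn, ?_, ?_, hm ▸ hns, hret, fun t' ht'0 ht' hrec' hfut' => ?_⟩
  · intro i hi
    rw [hr'' i hi]
    exact hconf (t + i) (by omega) (by omega)
  · intro i hi
    rw [hm, hr'' i hi.le]
    exact hrec (t + i) (by omega)
  by_contra hle
  push Not at hle
  rw [hr'' t' ht'.le] at hle
  have key := hren (t + t') (by omega) (by omega) ?_ ?_
  · linarith
  · -- `t + t'` is a strict record of the whole profile
    intro i hi
    rcases Nat.eq_zero_or_pos i with rfl | hi0
    · rw [h0]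
      exact hconf (t + t') (by omega) (by omega)
    · rcases lt_or_ge i t with hit | hit
      · have hsi : s < r i := by
          by_contra hle'
          exact hmin i hit ⟨hi0, hit.trans htn, not_lt.1 hle'⟩
        exact lt_of_le_of_lt hle hsi
      · obtain ⟨k, rfl⟩ : ∃ k, i = t + k := ⟨i - t, by omega⟩
        have hk := hrec' k (by omega)
        rwa [hr'' t' ht'.le, hr'' k (by omega)] at hk
  · -- its whole future is closer
    intro j htj hjn
    obtain ⟨k, rfl⟩ : ∃ k, j = t + k := ⟨j - t, by omega⟩
    have hk := hfut' k (by omega) (by omega)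
    rwa [hr'' k (by omega), hr'' t' ht'.le] at hk

/-! ### The first-entry factorisation with irreducible suffix -/

/-- **First-entry factorisation of the skip mass, irreducible suffix.**  For `A > 1`, a centre `z`, a
start `u`, a level
`s ≤ dist (Site.toComplex u) z / A` and `N`: cutting a skipping member at its first entry `t₁` into
the closed `s`-disc gives either the member itself (`t₁ = n`: an annular bridge of the crux's family
`annMass z s (dist (Site.toComplex u) z) u N`, the last sum) or an annular bridge `β` of length
`m = t₁` followed by a returning record-ending descent from `u + β m` (the inner sum: length
`0 < k ≤ N`, confined to the open disc of radius `dist (Site.toComplex u) z`, end = strict record of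
radius `≤ s`, radius `≥ dist (Site.toComplex (u + β m)) z` reached at some `0 < j < k`, and no radial renewal
time of radius `≤ s` before the end); the cut is
injective and the weights multiply, whence the inequality. [folklore] -/
theorem rr_st_firstEntry_factorisation_irr :
    ∀ A : ℝ, 1 < A → ∀ (z : ℂ) (u : Site 2) (s : ℝ), s ≤ dist (Site.toComplex u) z / A → ∀ N : ℕ,
      (∑ n ∈ Finset.range (N + 1),
        ∑ _ω ∈ (SAW.Zd.saws 2 n).filter (fun ω =>
          dist (Site.toComplex (u + ω n)) z ≤ s ∧
          0 < n ∧
          (∀ i, 0 < i → i ≤ n → dist (Site.toComplex (u + ω i)) z < dist (Site.toComplex u) z) ∧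
          (∀ i, i < n → dist (Site.toComplex (u + ω n)) z < dist (Site.toComplex (u + ω i)) z) ∧
          dist (Site.toComplex (u + ω n)) z ≤ dist (Site.toComplex u) z / A ∧
          (∀ t, 0 < t → t < n →
            (∀ i, i < t → dist (Site.toComplex (u + ω t)) z < dist (Site.toComplex (u + ω i)) z) →
            (∀ j, t < j → j ≤ n → dist (Site.toComplex (u + ω j)) z < dist (Site.toComplex (u + ω t)) z) →
            dist (Site.toComplex u) z / A < dist (Site.toComplex (u + ω t)) z)),
          SAW.criticalFugacity ^ n) ≤
      (∑ m ∈ Finset.range (N + 1),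
        ∑ η ∈ (SAW.Zd.saws 2 m).filter (fun η =>
            (∀ i, 0 < i → i < m → s < dist (Site.toComplex (u + η i)) z ∧
              dist (Site.toComplex (u + η i)) z < dist (Site.toComplex u) z) ∧
            dist (Site.toComplex (u + η m)) z ≤ s),
          SAW.criticalFugacity ^ m *
            (∑ k ∈ Finset.range (N + 1),
                ∑ _τ ∈ (SAW.Zd.saws 2 k).filter (fun τ =>
                  0 < k ∧
                  (∀ i, i ≤ k → dist (Site.toComplex (u + η m + τ i)) z < dist (Site.toComplex u) z) ∧
                  (∀ i, i < k → dist (Site.toComplex (u + η m + τ k)) z <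
                    dist (Site.toComplex (u + η m + τ i)) z) ∧
                  dist (Site.toComplex (u + η m + τ k)) z ≤ s ∧
                  (∃ j, 0 < j ∧ j < k ∧ dist (Site.toComplex (u + η m)) z ≤
                    dist (Site.toComplex (u + η m + τ j)) z) ∧
                  (∀ t, 0 < t → t < k →
                    (∀ i, i < t → dist (Site.toComplex (u + η m + τ t)) z <
                      dist (Site.toComplex (u + η m + τ i)) z) →
                    (∀ j, t < j → j ≤ k → dist (Site.toComplex (u + η m + τ j)) z <
                      dist (Site.toComplex (u + η m + τ t)) z) →
                    s < dist (Site.toComplex (u + η m + τ t)) z)),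
                  SAW.criticalFugacity ^ k)) +
      (∑ n ∈ Finset.range (N + 1),
        ∑ _ω ∈ (SAW.Zd.saws 2 n).filter (fun ω =>
          (∀ i, 0 < i → i < n → s < dist (Site.toComplex (u + ω i)) z ∧
            dist (Site.toComplex (u + ω i)) z < dist (Site.toComplex u) z) ∧
          dist (Site.toComplex (u + ω n)) z ≤ s),
          SAW.criticalFugacity ^ n) := by
  intro A _ z u s hs N
  refine rr_fd_abstract_factorisation (α := ℕ → Site 2) criticalFugacity_pos.le N (SAW.Zd.saws 2)
    _ _ _ _ (fun n ω t => 0 < t ∧ t < n ∧ dist (Site.toComplex (u + ω t)) z ≤ s)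
    (fun _ ω t => fun i => ω (min i t)) (fun n ω t => fun i => ω (t + min i (n - t)) - ω t)
    ?_ ?_ ?_
  · -- no entry before the end: an annular bridge
    intro n ω _ hC hno
    obtain ⟨hns, -, hconf, -, -, -⟩ := hC
    refine ⟨fun i hi0 hin => ⟨?_, hconf i hi0 hin.le⟩, hns⟩
    by_contra hle
    exact hno i ⟨hi0, hin, not_lt.1 hle⟩
  · -- the cut at the first entry
    intro n ω t hω hC hgood hmin
    obtain ⟨ht0, htn, hts⟩ := hgood
    have h0 : dist (Site.toComplex (u + ω 0)) z = dist (Site.toComplex u) z := by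
      rw [(SAW.Zd.mem_saws.1 hω).1, add_zero]
    refine ⟨htn.le, rr_fd_prefix_mem_saws hω htn.le, ?_, rr_fd_suffix_mem_saws hω htn.le, ?_⟩
    · -- the prefix up to the first entry is an annular bridge
      refine ⟨fun i hi0 hit => ?_, by simpa only [min_self] using hts⟩
      simp only [min_eq_left hit.le]
      refine ⟨?_, hC.2.2.1 i hi0 (hit.le.trans htn.le)⟩
      by_contra hle
      exact hmin i hit ⟨hi0, hit.trans htn, not_lt.1 hle⟩
    · exact rr_st_profile_suffix_irr (r := fun k => dist (Site.toComplex (u + ω k)) z)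
        (r'' := fun i =>
          dist (Site.toComplex (u + ω (min t t) + (ω (t + min i (n - t)) - ω t))) z)
        (ρw := dist (Site.toComplex (u + ω (min t t))) z)
        hC hs h0 ht0 htn hts hmin (by simp only [min_self])
        (fun i hi => by simp only [min_self, min_eq_left hi, add_add_sub_cancel])
  · -- injectivity of the cut
    exact fun t n ω n' ω' hω hω' htn htn' h1 h2 h3 => rr_fd_cut_injective hω hω' htn htn' h1 h2 h3

/-! ### S3 from crux-type decay and boundedness of the irreducible returning descents -/

/-- **`AnnularMassDecay ∧ RetIrrBounded ⟹ SkipTail`** (registered helper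
`rr_st_skipTail_of_annularDecay_irr` for `stub_skipTail`).  Hypotheses: (i) the crux-type decay of the
first-entry annular mass, verbatim the crux `AnnularMassDecay` (`annMass z r R u N ≤ C (r/R)^θ` for
`1 ≤ r < R ≤ dist (Site.toComplex u) z`); (ii) a uniform bound `K` on the `x_c`-mass of returning
RADIALLY IRREDUCIBLE record-ending descents from `w` (confined to the open `ρ`-disc about `z`,
end = strict record of radius `≤ s`, radius `≥ dist (Site.toComplex w) z` reached before the end,
no radial renewal time of radius `≤ s` before the end) for `1 ≤ s`,
`dist (Site.toComplex w) z ≤ s < ρ`.  Conclusion: S3 verbatim, with `κ = θ` and constant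
`(max K 0 + 1) · max C 0`: by `rr_st_firstEntry_factorisation_irr` at `s = dist (Site.toComplex u) z /
(A·B)`, `Skip ≤ (max K 0 + 1) · annMass z s (dist (Site.toComplex u) z) u N ≤ (max K 0 + 1) · C ·
(A·B)^{-θ}`.  Both hypotheses are open (critical `x_c`-masses
on `ℤ²`); (i) is the crux itself and (ii) is of the strength of `stub_chainBounded` for bulk starts,
so this records the logical position of S3, not a route to it. [folklore] -/
theorem rr_st_skipTail_of_annularDecay_irr :
    (∃ θ C : ℝ, 0 < θ ∧ ∀ (z : ℂ) (r R : ℝ), 1 ≤ r → r < R → ∀ u : Site 2,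
      R ≤ dist (Site.toComplex u) z → ∀ N : ℕ,
      (∑ n ∈ Finset.range (N + 1),
        ∑ _ω ∈ (SAW.Zd.saws 2 n).filter (fun ω =>
          (∀ i, 0 < i → i < n → r < dist (Site.toComplex (u + ω i)) z ∧
            dist (Site.toComplex (u + ω i)) z < R) ∧
          dist (Site.toComplex (u + ω n)) z ≤ r),
          SAW.criticalFugacity ^ n) ≤ C * (r / R) ^ θ) →
    (∃ K : ℝ, ∀ (z : ℂ) (w : Site 2) (ρ s : ℝ) (N : ℕ), 1 ≤ s → dist (Site.toComplex w) z ≤ s →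
      s < ρ →
      (∑ k ∈ Finset.range (N + 1),
        ∑ _τ ∈ (SAW.Zd.saws 2 k).filter (fun τ =>
          0 < k ∧
          (∀ i, i ≤ k → dist (Site.toComplex (w + τ i)) z < ρ) ∧
          (∀ i, i < k → dist (Site.toComplex (w + τ k)) z < dist (Site.toComplex (w + τ i)) z) ∧
          dist (Site.toComplex (w + τ k)) z ≤ s ∧
          (∃ j, 0 < j ∧ j < k ∧ dist (Site.toComplex w) z ≤ dist (Site.toComplex (w + τ j)) z) ∧
          (∀ t, 0 < t → t < k →
            (∀ i, i < t → dist (Site.toComplex (w + τ t)) z < dist (Site.toComplex (w + τ i)) z) →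
            (∀ j, t < j → j ≤ k → dist (Site.toComplex (w + τ j)) z < dist (Site.toComplex (w + τ t)) z) →
            s < dist (Site.toComplex (w + τ t)) z)),
          SAW.criticalFugacity ^ k) ≤ K) →
    ∀ A : ℝ, 1 < A → ∃ κ C : ℝ, 0 < κ ∧ ∀ B : ℝ, 1 ≤ B → ∀ (z : ℂ) (u : Site 2),
      A * B ≤ dist (Site.toComplex u) z → ∀ N : ℕ,
      (∑ n ∈ Finset.range (N + 1),
        ∑ _ω ∈ (SAW.Zd.saws 2 n).filter (fun ω =>
          dist (Site.toComplex (u + ω n)) z ≤ dist (Site.toComplex u) z / (A * B) ∧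
          0 < n ∧
          (∀ i, 0 < i → i ≤ n → dist (Site.toComplex (u + ω i)) z < dist (Site.toComplex u) z) ∧
          (∀ i, i < n → dist (Site.toComplex (u + ω n)) z < dist (Site.toComplex (u + ω i)) z) ∧
          dist (Site.toComplex (u + ω n)) z ≤ dist (Site.toComplex u) z / A ∧
          (∀ t, 0 < t → t < n →
            (∀ i, i < t → dist (Site.toComplex (u + ω t)) z < dist (Site.toComplex (u + ω i)) z) →
            (∀ j, t < j → j ≤ n → dist (Site.toComplex (u + ω j)) z < dist (Site.toComplex (u + ω t)) z) →
            dist (Site.toComplex u) z / A < dist (Site.toComplex (u + ω t)) z)),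
          SAW.criticalFugacity ^ n) ≤ C * B ^ (-κ) := by
  rintro ⟨θ, C, hθ, hD⟩ ⟨K, hK⟩ A hA
  refine ⟨θ, (max K 0 + 1) * max C 0, hθ, fun B hB z u hAB N => ?_⟩
  have hABpos : 0 < A * B := by positivity
  have hB0 : 0 < B := by linarith
  have hρpos : 0 < dist (Site.toComplex u) z := lt_of_lt_of_le hABpos hAB
  have hAB1 : 1 < A * B := by nlinarith
  have hs1 : 1 ≤ dist (Site.toComplex u) z / (A * B) := by rwa [le_div_iff₀ hABpos, one_mul]
  have hslt : dist (Site.toComplex u) z / (A * B) < dist (Site.toComplex u) z :=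
    div_lt_self hρpos hAB1
  have hsle : dist (Site.toComplex u) z / (A * B) ≤ dist (Site.toComplex u) z / A :=
    div_le_div_of_nonneg_left hρpos.le (by linarith) (by nlinarith)
  have hx : 0 ≤ SAW.criticalFugacity := criticalFugacity_pos.le
  -- the crux-type decay at `R = dist (Site.toComplex u) z`, `r = dist (Site.toComplex u) z / (A * B)`
  have hann := hD z (dist (Site.toComplex u) z / (A * B)) (dist (Site.toComplex u) z) hs1 hslt u
    le_rfl N
  have hcmp : C * (dist (Site.toComplex u) z / (A * B) / dist (Site.toComplex u) z) ^ θ ≤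
      max C 0 * B ^ (-θ) := by
    have hq : dist (Site.toComplex u) z / (A * B) / dist (Site.toComplex u) z = (A * B)⁻¹ := by
      field_simp
    rw [hq, Real.inv_rpow hABpos.le, ← Real.rpow_neg hABpos.le]
    calc C * (A * B) ^ (-θ) ≤ max C 0 * (A * B) ^ (-θ) :=
          mul_le_mul_of_nonneg_right (le_max_left _ _) (Real.rpow_nonneg hABpos.le _)
      _ ≤ max C 0 * B ^ (-θ) :=
          mul_le_mul_of_nonneg_left
            (Real.rpow_le_rpow_of_nonpos hB0 (by nlinarith) (by linarith)) (le_max_right _ _)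
  refine (rr_st_firstEntry_factorisation_irr A hA z u _ hsle N).trans ?_
  -- bound every returning-descent factor by `max K 0`
  have hmain : ∀ (m : ℕ) (η : ℕ → Site 2), η ∈ (SAW.Zd.saws 2 m).filter (fun η =>
        (∀ i, 0 < i → i < m → dist (Site.toComplex u) z / (A * B) < dist (Site.toComplex (u + η i)) z ∧
          dist (Site.toComplex (u + η i)) z < dist (Site.toComplex u) z) ∧
        dist (Site.toComplex (u + η m)) z ≤ dist (Site.toComplex u) z / (A * B)) →
      SAW.criticalFugacity ^ m *
        (∑ k ∈ Finset.range (N + 1),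
          ∑ _τ ∈ (SAW.Zd.saws 2 k).filter (fun τ =>
            0 < k ∧
            (∀ i, i ≤ k → dist (Site.toComplex (u + η m + τ i)) z < dist (Site.toComplex u) z) ∧
            (∀ i, i < k → dist (Site.toComplex (u + η m + τ k)) z <
              dist (Site.toComplex (u + η m + τ i)) z) ∧
            dist (Site.toComplex (u + η m + τ k)) z ≤ dist (Site.toComplex u) z / (A * B) ∧
            (∃ j, 0 < j ∧ j < k ∧ dist (Site.toComplex (u + η m)) z ≤
              dist (Site.toComplex (u + η m + τ j)) z) ∧
            (∀ t, 0 < t → t < k →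
              (∀ i, i < t → dist (Site.toComplex (u + η m + τ t)) z <
                dist (Site.toComplex (u + η m + τ i)) z) →
              (∀ j, t < j → j ≤ k → dist (Site.toComplex (u + η m + τ j)) z <
                dist (Site.toComplex (u + η m + τ t)) z) →
              dist (Site.toComplex u) z / (A * B) < dist (Site.toComplex (u + η m + τ t)) z)),
            SAW.criticalFugacity ^ k) ≤
      SAW.criticalFugacity ^ m * max K 0 := by
    intro m η hη
    have hend := (Finset.mem_filter.1 hη).2.2
    exact mul_le_mul_of_nonneg_left
      ((hK z (u + η m) (dist (Site.toComplex u) z) _ N hs1 hend hslt).trans (le_max_left _ _))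
      (pow_nonneg hx m)
  have hsum := Finset.sum_le_sum fun m (_ : m ∈ Finset.range (N + 1)) =>
    Finset.sum_le_sum fun η hη => hmain m η hη
  refine (add_le_add hsum hann).trans ?_
  have hfac : ∀ (S : ℕ → Finset (ℕ → Site 2)),
      (∑ m ∈ Finset.range (N + 1), ∑ _η ∈ S m, SAW.criticalFugacity ^ m * max K 0) =
        max K 0 * ∑ m ∈ Finset.range (N + 1), ∑ _η ∈ S m, SAW.criticalFugacity ^ m := by
    intro S
    rw [Finset.mul_sum]
    refine Finset.sum_congr rfl fun m _ => ?_
    rw [Finset.mul_sum]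
    exact Finset.sum_congr rfl fun _ _ => mul_comm _ _
  rw [hfac]
  have hK0 : 0 ≤ max K 0 + 1 := by positivity
  calc _ ≤ max K 0 * (C * (dist (Site.toComplex u) z / (A * B) / dist (Site.toComplex u) z) ^ θ) +
        C * (dist (Site.toComplex u) z / (A * B) / dist (Site.toComplex u) z) ^ θ :=
        add_le_add (mul_le_mul_of_nonneg_left hann (le_max_right _ _)) le_rfl
    _ = (max K 0 + 1) *
        (C * (dist (Site.toComplex u) z / (A * B) / dist (Site.toComplex u) z) ^ θ) := by ring
    _ ≤ (max K 0 + 1) * (max C 0 * B ^ (-θ)) := mul_le_mul_of_nonneg_left hcmp hK0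
    _ = (max K 0 + 1) * max C 0 * B ^ (-θ) := by ring

end Summit.CriticalPhenomena.SAWScalingLimit.Theorems.AnnularMassDecay.Radial

end
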